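import Summits.ValiantsHypothesis.ValiantsHypothesis.Theorems.SymPencilPerFourTwoLineFilterLeaf
import Summits.ValiantsHypothesis.ValiantsHypothesis.Theorems.SymPencilPerFourTwoLineFilter
import Summits.ValiantsHypothesis.ValiantsHypothesis.Theorems.SymPencilPerFourTwoLineFilterSeven

/-!
# Route `SymPencil` — row `r = 10` of the size-`28` table: the threshold-shifted declarations of
# `SymPencilPerFourTwoLineFilterLeaf` (`--supports` stmt-ValiantsHypothesis-5674 `SdcSuperquadratic`; rung currency only)

The declarations below (suffix `_m28`) are those of the landed `…Theorems.SymPencilPerFourTwoLineFilterLeaf` whose meaning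
changes when its numerical thresholds move by one unit — `Fin 6 → Fin 7` square families /
`|ι'| ≤ 26 → ≤ 27` / `m ≤ 27 → m ≤ 28`, as applicable — with proofs VERBATIM; unchanged
declarations are used from the original module by name (same namespace).  Why it elaborates
(m = 28 table audit, val-lit-p6 g17, 2026-08-29; reader of record val-idea-crit-5 g4, probe P31):
the leaves of the `(10, 6)` chain are stated for `card ι < 8` / `< 9`, and every size lever reads
`4·rk bL ≤ 2·dim K + |ι'|` through integer division — one unit of slack throughout.  The `_m28`
statements imply the landed ones.

Honest framing: part of ONE row (cell `(10, 6, 7)`) of the size-`28` table; nothing about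
`sdc(per_4)` follows here; `28 ≤ sdc(per_4) ≤ 29` of record, the crux `SdcSuperquadratic` and
`VP ≠ VNP` untouched.  Credit: mathematics and proof text of `SymPencilPerFourTwoLineFilterLeaf` (its authors); this file only
moves the bound.  No definitions, no named facts. [folklore]
-/

noncomputable section

-- single-conjunct layout: Sub = Summit, duplicated namespace component intended
set_option linter.dupNamespace false

namespace Summit.ValiantsHypothesis.ValiantsHypothesis.Theorems.SymPencilPerFourTwoLineFilterLeaf

open Matrix MvPolynomial Finset Module
open Literature.Computability.AlgebraicComplexity
open Summit.ValiantsHypothesis.ValiantsHypothesis.Theorems.SymPencilPerFourTwoLineFilter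
open Summit.ValiantsHypothesis.ValiantsHypothesis.Theorems.SymPencilPerFourPairingDiscSixOnto
open Summit.ValiantsHypothesis.ValiantsHypothesis.Theorems.SymPencilPerFourLowRankSeven
open Summit.ValiantsHypothesis.ValiantsHypothesis.Theorems.SymPencilPerFourTwoRowsRadical

variable {K : Type*} [Field K]

/-- **Rows.**  Two identically-zero rows + `dim 6` + per-direction `≤ 6` squares ⇒ `W_col`-type
or `W₂`-type. [folklore] -/
theorem rows_filter_m28 [CharZero K] (W : Submodule K (Fin 4 × Fin 4 → K)) (h6 : finrank K W = 6)
    (hzero : ∃ p q : Fin 4, p ≠ q ∧ ∀ x ∈ W, ∀ j : Fin 4, x (p, j) = 0 ∧ x (q, j) = 0)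
    (hP : ∀ y ∈ W, ∃ (c : Fin 7 → K) (Λ : Fin 7 → ((Fin 4 × Fin 4 → K) →ₗ[K] K)),
      ∀ u : Fin 4 × Fin 4 → K, ∃ e₀ e₁ : K, ∀ s : K,
        eval (u + s • y) (perPoly (Fin 4) K) = e₀ + s * e₁ + s ^ 2 * ∑ k, c k * (Λ k u) ^ 2) :
    (∃ p q m : Fin 4, p ≠ q ∧ ∀ x : Fin 4 × Fin 4 → K, x ∈ W ↔
        ((∀ i j : Fin 4, i ≠ p → i ≠ q → x (i, j) = 0) ∧ x (p, m) = 0 ∧ x (q, m) = 0)) ∨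
    (∃ p q m m' : Fin 4, p ≠ q ∧ m ≠ m' ∧ ∀ x : Fin 4 × Fin 4 → K, x ∈ W ↔
        ((∀ i j : Fin 4, i ≠ p → i ≠ q → x (i, j) = 0) ∧ x (q, m) = 0 ∧ x (q, m') = 0)) := by
  obtain ⟨p, q, hpq, hzero⟩ := hzero
  obtain ⟨a, b, hab, hap, haq, hbp, hbq⟩ := exists_compl_pair p q hpq
  have hrows : ∀ x ∈ W, ∀ i j : Fin 4, i ≠ a → i ≠ b → x (i, j) = 0 := by
    intro x hx i j hia hib
    rcases fin4_of_two_pairs p q a b i hpq hab hap haq hbp hbq hia hib with rfl | rfl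
    · exact (hzero x hx j).1
    · exact (hzero x hx j).2
  rcases twoRows_filter_m28 W h6 a b hab hrows hP with ⟨m, hm⟩ | ⟨m, m', hmm, hm⟩ | ⟨m, m', hmm, hm⟩
  · exact Or.inl ⟨a, b, m, hab, hm⟩
  · exact Or.inr ⟨a, b, m, m', hab, hmm, hm⟩
  · exact Or.inr ⟨b, a, m, m', hab.symm, hmm, hm⟩
/-- **LEAF 5 — TWO-LINE FILTER**, verbatim from
`Cruxes/SdcSuperquadratic/Lines/sing_six_classification.lean` with the definitions unfolded.
[folklore] -/
theorem stub_twoLineFilter_m28 [CharZero K] :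
    ∀ W : Submodule K (Fin 4 × Fin 4 → K), finrank K W = 6 →
      ((∃ p q : Fin 4, p ≠ q ∧ ∀ x ∈ W, ∀ j : Fin 4, x (p, j) = 0 ∧ x (q, j) = 0) ∨
       (∃ p q : Fin 4, p ≠ q ∧ ∀ x ∈ W, ∀ i : Fin 4, x (i, p) = 0 ∧ x (i, q) = 0)) →
      (∀ y ∈ W, ∃ (c : Fin 7 → K) (Λ : Fin 7 → ((Fin 4 × Fin 4 → K) →ₗ[K] K)),
        ∀ u : Fin 4 × Fin 4 → K, ∃ e₀ e₁ : K, ∀ s : K,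
          eval (u + s • y) (perPoly (Fin 4) K) = e₀ + s * e₁ + s ^ 2 * ∑ k, c k * (Λ k u) ^ 2) →
      (∃ p q m : Fin 4, p ≠ q ∧ ∀ x : Fin 4 × Fin 4 → K, x ∈ W ↔
          ((∀ i j : Fin 4, i ≠ p → i ≠ q → x (i, j) = 0) ∧ x (p, m) = 0 ∧ x (q, m) = 0)) ∨
      (∃ p q m m' : Fin 4, p ≠ q ∧ m ≠ m' ∧ ∀ x : Fin 4 × Fin 4 → K, x ∈ W ↔
          ((∀ i j : Fin 4, i ≠ p → i ≠ q → x (i, j) = 0) ∧ x (q, m) = 0 ∧ x (q, m') = 0)) ∨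
      (∃ p q m : Fin 4, p ≠ q ∧ ∀ x : Fin 4 × Fin 4 → K, x ∈ W ↔
          ((∀ i j : Fin 4, j ≠ p → j ≠ q → x (i, j) = 0) ∧ x (m, p) = 0 ∧ x (m, q) = 0)) ∨
      (∃ p q m m' : Fin 4, p ≠ q ∧ m ≠ m' ∧ ∀ x : Fin 4 × Fin 4 → K, x ∈ W ↔
          ((∀ i j : Fin 4, j ≠ p → j ≠ q → x (i, j) = 0) ∧ x (m, q) = 0 ∧ x (m', q) = 0)) := by
  intro W h6 hz hP
  rcases hz with hrows | hcols
  · rcases rows_filter_m28 W h6 hrows hP with h | h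
    · exact Or.inl h
    · exact Or.inr (Or.inl h)
  · -- transpose
    set Φ : (Fin 4 × Fin 4 → K) ≃ₗ[K] (Fin 4 × Fin 4 → K) :=
      LinearEquiv.funCongrLeft K K (Equiv.prodComm (Fin 4) (Fin 4)) with hΦ
    have hΦa : ∀ (x : Fin 4 × Fin 4 → K) (i j : Fin 4), Φ x (i, j) = x (j, i) := fun x i j => rfl
    set W' := W.map Φ.toLinearMap with hW'def
    have hfin : finrank K W' = 6 := by rw [hW'def, LinearEquiv.finrank_map_eq, h6]
    have hP' := sqFamilySwap_map W Φ eval_perPoly_transpose hP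
    have hmemW : ∀ x : Fin 4 × Fin 4 → K, x ∈ W ↔ Φ x ∈ W' := fun x => by
      rw [hW'def, Submodule.mem_map_equiv, LinearEquiv.symm_apply_apply]
    have hmemW' : ∀ x', x' ∈ W' → ∃ x ∈ W, x' = Φ x := fun x' hx' => by
      rw [hW'def, Submodule.mem_map] at hx'
      obtain ⟨x, hx, rfl⟩ := hx'
      exact ⟨x, hx, rfl⟩
    obtain ⟨p, q, hpq, hc⟩ := hcols
    have hrows' : ∃ p q : Fin 4, p ≠ q ∧ ∀ x ∈ W', ∀ j : Fin 4, x (p, j) = 0 ∧ x (q, j) = 0 := by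
      refine ⟨p, q, hpq, fun x' hx' j => ?_⟩
      obtain ⟨x, hx, rfl⟩ := hmemW' x' hx'
      rw [hΦa, hΦa]
      exact hc x hx j
    rcases rows_filter_m28 W' hfin hrows' hP' with ⟨p', q', m, hpq', hm⟩ | ⟨p', q', m, m', hpq', hmm, hm⟩
    · right; right; left
      refine ⟨p', q', m, hpq', fun x => ?_⟩
      rw [hmemW x, hm (Φ x)]
      simp only [hΦa]
      exact ⟨fun ⟨h1, h2, h3⟩ => ⟨fun i j hj hj' => h1 j i hj hj', h2, h3⟩,
        fun ⟨h1, h2, h3⟩ => ⟨fun i j hi hi' => h1 j i hi hi', h2, h3⟩⟩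
    · right; right; right
      refine ⟨p', q', m, m', hpq', hmm, fun x => ?_⟩
      rw [hmemW x, hm (Φ x)]
      simp only [hΦa]
      exact ⟨fun ⟨h1, h2, h3⟩ => ⟨fun i j hj hj' => h1 j i hj hj', h2, h3⟩,
        fun ⟨h1, h2, h3⟩ => ⟨fun i j hi hi' => h1 j i hi hi', h2, h3⟩⟩
end Summit.ValiantsHypothesis.ValiantsHypothesis.Theorems.SymPencilPerFourTwoLineFilterLeaf

end
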